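import Summits.Ventures.WeilGRH.MinorantZetaTransfer
import Literature.Analysis.SpecialFunctions.SechCosineTransform
import HarnessLib

/-!
# GRH arm (rh-explicit, venture WeilGRH): THE ODD `ζ`-TRANSFER FLOOR LAW —
  the parity (sech) bonus lowers the floor `2(sinh t + t)` for ODD characters, in closed form

Cell `rh-explicit`, WEIL TRACK — GRH ARM (engine/certificate seat weil-grh-2, gen6; sequel of
`MinorantZetaTransfer.lean`).  For an ODD character the all-trivial pseudo-key of parity `1` is the minorant
(`KeyMinorantParity.weilPositivityOnChar_of_allTrivial_test_nonneg` at `a = 1`), and on test functions `g`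
supported in `[-t, t]`
  `keyMarkovForm 1 L 1 t g = Re Q_ζ(g) − P(g) + L‖g‖₂² + Π(g)`,
  `Π(g) = (1/2π)∫|ĝ(½+iτ)|² π sech(πτ) dτ`                 (`keyMarkovForm_one_eq_zero_add_sech`;
                                                          `KeyParityTransfer.weilFinitePrimeQuadraticKey_one_eq_zero_add`).
Two rank-one facts control the two non-`ζ` terms:
* the pole form is `P(g) = 2‖x‖² − 2‖s‖² ≤ 2‖x‖²`, `x = ∫ g cosh(u/2) du` (`weilPoleForm`, Yoshida (6.2));
* ★ the parity form DOMINATES the rank-one form at the kernel column: `Π(g) ≥ 2‖Y‖²`, `Y = ∫ g(u) du/(2cosh(u/2))`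
  (`two_mul_norm_sq_sech_pairing_le`: Cauchy–Schwarz against the weight `π sech(πτ)`, `∫ π sech(πτ) dτ = π`, and the
  tree's Fourier pair `∫ ĝ(½+iτ) π sech(πτ) dτ = 2π Y`, `WeilArchParity.integral_weilMellin_mul_sech_eq`; in position
  space this is the positive-definiteness of `sech((u−v)/2) − sech(u/2)sech(v/2) = tanh(u/2) sech((u−v)/2) tanh(v/2)`).
Then for every real `γ` with `γ² < 1`, by `‖x + γY‖² − ‖γx + Y‖² = (1 − γ²)(‖x‖² − ‖Y‖²)` and Cauchy–Schwarz against the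
profile `e_γ(u) = cosh(u/2) + γ/(2cosh(u/2))` on `[-t, t]`, whose energy is
`E(t, γ) = ∫_{-t}^{t} e_γ² = sinh t + t + 2γt + γ² tanh(t/2)` (`integral_Icc_cosh_add_sech_sq`),

  `2‖x‖² − 2‖Y‖² ≤ 2E(t, γ)‖g‖₂²/(1 − γ²)`.
**THEOREM (`weilPositivityOnChar_odd_of_weilPositivityOn`).**  `0 < t`, `WeilPositivityOn t` (for `ζ`), `q ≠ 1`,
`γ² < 1`, `2E(t, γ) ≤ (1 − γ²) log q` ⇒ `WeilPositivityOnChar χ t` for EVERY ODD Dirichlet character `χ` mod `q`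
(`γ = 0` is the even law of `MinorantZetaTransfer.lean`; the optimum `γ ≈ −½` gains about one unit of `log q`).
UNCONDITIONAL for `t ≤ 4023/5000` (`weilPositivityOnChar_odd_of_le_frontier_of_le`); the named odd floors
(`3, 4, 6, 7, 10, 11, 12`, ★ `14` at the frontier — cell data `14`; `31` at `t = 1` conditionally — data `30`) are
`MinorantZetaTransferOddRungs.lean`.  Honest scope: nothing here is a step towards RH or GRH; the unconditional
statements stop at the `ζ` frontier.  Everything is PROVED; no definitions, no named facts; standard axioms.

## References

* A. Weil (1952), (10) p. 258, (11) pp. 261–262 (`K_{1,0} − K_{1,1} = 1/(e^{x/2} + e^{−x/2})`), the «lemme» p. 262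
  [Weil1952FormulesExplicites]; H. Yoshida (1992), §6 (6.2) [Yoshida1992]; E. Bombieri (2000), Thm 2 p. 193
  [Bombieri2000Weil].
-/

set_option autoImplicit false

noncomputable section

open Complex Set MeasureTheory Finset
open scoped Real

namespace Summit.Ventures.WeilGRH

open Literature.NumberTheory.LFunctions

variable {q : ℕ} {g : ℝ → ℂ}

/-! ## The sech form of the parity term dominates a rank-one form at the kernel column -/

/-- `∫ π / cosh(πτ) dτ = π`. [folklore] -/
theorem integral_pi_div_cosh_pi_mul : ∫ τ : ℝ, π / Real.cosh (π * τ) = π := by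
  have h := Literature.Analysis.SpecialFunctions.integral_univ_cos_div_cosh Real.pi_pos 0
  simp only [zero_mul, Real.cos_zero, mul_zero, zero_div, Real.cosh_zero, div_one,
    div_self Real.pi_pos.ne'] at h
  have e : (fun τ : ℝ ↦ π / Real.cosh (π * τ)) = fun τ ↦ π * (1 / Real.cosh (π * τ)) := by
    funext τ; ring
  rw [e, integral_const_mul, h, mul_one]

/-- `τ ↦ π / cosh(πτ)` is integrable. [folklore] -/
theorem integrable_pi_div_cosh_pi_mul : Integrable fun τ : ℝ ↦ π / Real.cosh (π * τ) :=
  Integrable.of_integral_ne_zero (by rw [integral_pi_div_cosh_pi_mul]; exact Real.pi_pos.ne')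

/-- Pointwise AM–GM: `‖z‖ ≤ (μ/2)‖z‖² + 1/(2μ)` for `μ > 0`. [folklore] -/
theorem norm_le_half_mul_sq_add (z : ℂ) {μ : ℝ} (hμ : 0 < μ) : ‖z‖ ≤ μ / 2 * ‖z‖ ^ 2 + 1 / (2 * μ) := by
  have h1 : μ / 2 * ‖z‖ ^ 2 + 1 / (2 * μ) - ‖z‖ = (μ * ‖z‖ - 1) ^ 2 / (2 * μ) := by
    field_simp
    ring
  have h2 : 0 ≤ (μ * ‖z‖ - 1) ^ 2 / (2 * μ) := by positivity
  linarith

/-- **Weighted Cauchy–Schwarz on the line** (AM–GM form): for a continuous bounded `f : ℝ → ℂ` and a positive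
integrable weight `w` with `∫ w = W`, `‖∫ f w‖² ≤ W ∫ ‖f‖² w`. [folklore] -/
theorem norm_sq_integral_mul_weight_le {f : ℝ → ℂ} {w : ℝ → ℝ} {W B : ℝ} (hfc : Continuous f)
    (hfb : ∀ τ, ‖f τ‖ ≤ B) (hw0 : ∀ τ, 0 < w τ) (hwc : Continuous w) (hwi : Integrable w)
    (hW : ∫ τ : ℝ, w τ = W) (hA : Integrable fun τ ↦ ‖f τ‖ ^ 2 * w τ) :
    ‖∫ τ : ℝ, f τ * (w τ : ℂ)‖ ^ 2 ≤ W * ∫ τ : ℝ, ‖f τ‖ ^ 2 * w τ := by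
  have hfw : Integrable fun τ ↦ ‖f τ‖ * w τ := by
    refine (hwi.const_mul B).mono' (hfc.norm.mul hwc).aestronglyMeasurable
      (Filter.Eventually.of_forall fun τ ↦ ?_)
    rw [Real.norm_of_nonneg (mul_nonneg (norm_nonneg _) (hw0 τ).le)]
    exact mul_le_mul_of_nonneg_right (hfb τ) (hw0 τ).le
  have hA0 : 0 ≤ ∫ τ : ℝ, ‖f τ‖ ^ 2 * w τ := integral_nonneg fun τ ↦ mul_nonneg (by positivity) (hw0 τ).le
  have hW0 : 0 ≤ W := by
    rw [← hW]; exact integral_nonneg fun τ ↦ (hw0 τ).le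
  -- `X ≤ (μ/2) A + W/(2μ)` for every `μ > 0`
  have hXle : ∀ μ : ℝ, 0 < μ →
      ‖∫ τ : ℝ, f τ * (w τ : ℂ)‖ ≤ μ / 2 * (∫ τ : ℝ, ‖f τ‖ ^ 2 * w τ) + W / (2 * μ) := by
    intro μ hμ
    have h1 : ‖∫ τ : ℝ, f τ * (w τ : ℂ)‖ ≤ ∫ τ : ℝ, ‖f τ‖ * w τ := by
      refine (norm_integral_le_integral_norm _).trans (le_of_eq ?_)
      refine integral_congr_ae (Filter.Eventually.of_forall fun τ ↦ ?_)
      simp only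
      rw [norm_mul, Complex.norm_real, Real.norm_of_nonneg (hw0 τ).le]
    have h2 : ∫ τ : ℝ, ‖f τ‖ * w τ ≤ ∫ τ : ℝ, (μ / 2 * (‖f τ‖ ^ 2 * w τ) + 1 / (2 * μ) * w τ) := by
      refine integral_mono hfw ((hA.const_mul _).add (hwi.const_mul _)) fun τ ↦ ?_
      have := mul_le_mul_of_nonneg_right (norm_le_half_mul_sq_add (f τ) hμ) (hw0 τ).le
      simp only at this ⊢
      linarith
    rw [integral_add (hA.const_mul _) (hwi.const_mul _), integral_const_mul, integral_const_mul, hW] at h2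
    have : 1 / (2 * μ) * W = W / (2 * μ) := by ring
    linarith
  -- optimise in `μ`
  rcases eq_or_lt_of_le (norm_nonneg (∫ τ : ℝ, f τ * (w τ : ℂ))) with h0 | hpos
  · rw [← h0]
    simpa using mul_nonneg hW0 hA0
  · rcases eq_or_lt_of_le hW0 with hW00 | hWpos
    · -- `W = 0`: then `X ≤ μ A/2` for all `μ`, so `X = 0`
      exfalso
      have h := hXle (‖∫ τ : ℝ, f τ * (w τ : ℂ)‖ / ((∫ τ : ℝ, ‖f τ‖ ^ 2 * w τ) + 1)) (by positivity)
      rw [← hW00, zero_div, add_zero] at h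
      have hA1 : 0 < (∫ τ : ℝ, ‖f τ‖ ^ 2 * w τ) + 1 := by linarith
      have : ‖∫ τ : ℝ, f τ * (w τ : ℂ)‖ / ((∫ τ : ℝ, ‖f τ‖ ^ 2 * w τ) + 1) / 2 *
          (∫ τ : ℝ, ‖f τ‖ ^ 2 * w τ) < ‖∫ τ : ℝ, f τ * (w τ : ℂ)‖ := by
        rw [div_div, div_mul_eq_mul_div, div_lt_iff₀ (by positivity)]
        nlinarith
      linarith
    · have h := hXle (W / ‖∫ τ : ℝ, f τ * (w τ : ℂ)‖) (by positivity)
      have e1 : W / (2 * (W / ‖∫ τ : ℝ, f τ * (w τ : ℂ)‖)) = ‖∫ τ : ℝ, f τ * (w τ : ℂ)‖ / 2 := by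
        field_simp
      rw [e1] at h
      have h3 : ‖∫ τ : ℝ, f τ * (w τ : ℂ)‖ ≤ W / ‖∫ τ : ℝ, f τ * (w τ : ℂ)‖ * ∫ τ : ℝ, ‖f τ‖ ^ 2 * w τ := by
        linarith
      have h4 := mul_le_mul_of_nonneg_right h3 hpos.le
      have e2 : W / ‖∫ τ : ℝ, f τ * (w τ : ℂ)‖ * (∫ τ : ℝ, ‖f τ‖ ^ 2 * w τ) * ‖∫ τ : ℝ, f τ * (w τ : ℂ)‖ =
          W * ∫ τ : ℝ, ‖f τ‖ ^ 2 * w τ := by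
        field_simp
      rw [sq]
      linarith

/-- **Cauchy–Schwarz against the sech weight on the critical line**: for a test function `g`,
`‖∫ ĝ(½+iτ) π sech(πτ) dτ‖² ≤ π ∫ |ĝ(½+iτ)|² π sech(πτ) dτ` (`∫ π sech(πτ) dτ = π`). [folklore] -/
theorem norm_sq_integral_weilMellin_mul_sech_le (hg : IsWeilTest g) :
    ‖∫ τ : ℝ, weilMellin g (1 / 2 + τ * I) * ((π / Real.cosh (π * τ) : ℝ) : ℂ)‖ ^ 2 ≤
      π * ∫ τ : ℝ, ‖weilMellin g (1 / 2 + τ * I)‖ ^ 2 * (π / Real.cosh (π * τ)) :=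
  norm_sq_integral_mul_weight_le (f := fun τ : ℝ ↦ weilMellin g (1 / 2 + τ * I))
    (w := fun τ : ℝ ↦ π / Real.cosh (π * τ))
    ((continuous_weilMellin hg.1.continuous hg.2).comp (by fun_prop : Continuous fun τ : ℝ ↦ (1 / 2 : ℂ) + τ * I))
    (norm_weilMellin_half_line_le hg)
    pi_div_cosh_pos (Continuous.div continuous_const (by fun_prop) fun τ ↦ (Real.cosh_pos _).ne')
    integrable_pi_div_cosh_pi_mul integral_pi_div_cosh_pi_mul (integrable_norm_sq_weilMellin_mul_pi_div_cosh hg)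

/-- ★ **The parity (sech) form dominates the rank-one form at the kernel column**: for a test function `g`,
`2‖∫ g(x)/(2cosh(x/2)) dx‖² ≤ (1/2π)∫|ĝ(½+iτ)|² π sech(πτ) dτ`
(`∫ ĝ(½+iτ) π sech(πτ) dτ = 2π ∫ g/(2cosh(x/2))`, `WeilArchParity.integral_weilMellin_mul_sech_eq`, and
Cauchy–Schwarz; position-space meaning: `sech((x−y)/2) − sech(x/2)sech(y/2) = tanh(x/2)sech((x−y)/2)tanh(y/2)` is a
positive-definite kernel). [cite: Weil1952FormulesExplicites, (10)–(11) pp. 258–262 (K_{1,0} − K_{1,1} = 1/(e^{x/2}+e^{−x/2}))] -/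
theorem two_mul_norm_sq_sech_pairing_le (hg : IsWeilTest g) :
    2 * ‖∫ x : ℝ, g x / (2 * Real.cosh (x / 2) : ℂ)‖ ^ 2 ≤
      1 / (2 * π) * ∫ τ : ℝ, ‖weilMellin g (1 / 2 + τ * I)‖ ^ 2 * (π / Real.cosh (π * τ)) := by
  have h := norm_sq_integral_weilMellin_mul_sech_le hg
  rw [WeilArchParity.integral_weilMellin_mul_sech_eq hg, norm_mul] at h
  have hn : ‖(2 * π : ℂ)‖ = 2 * π := by
    rw [show (2 * π : ℂ) = ((2 * π : ℝ) : ℂ) by push_cast; ring, Complex.norm_real,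
      Real.norm_of_nonneg (by positivity)]
  rw [hn, mul_pow] at h
  have hπ := Real.pi_pos
  rw [div_mul_eq_mul_div, one_mul, le_div_iff₀ (by positivity)]
  nlinarith [sq_nonneg ‖∫ x : ℝ, g x / (2 * Real.cosh (x / 2) : ℂ)‖]

/-! ## The odd pseudo-key on a window: `keyMarkovForm 1 = keyMarkovForm 0 + sech form` -/

/-- For a test function on `[-t, t]` and every level/datum:
`keyMarkovForm 1 L v t g = keyMarkovForm 0 L v t g + (1/2π)∫|ĝ(½+iτ)|² π sech(πτ) dτ`
(`KeyParityTransfer.weilFinitePrimeQuadraticKey_one_eq_zero_add` read in position space).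
[cite: Weil1952FormulesExplicites, (10)–(11) pp. 258–262] -/
theorem keyMarkovForm_one_eq_zero_add_sech (hg : IsWeilTest g) {t : ℝ} (hsupp : tsupport g ⊆ Icc (-t) t)
    (L : ℝ) (v : ℕ → ℂ) :
    keyMarkovForm 1 L v t g = keyMarkovForm 0 L v t g +
      1 / (2 * π) * ∫ τ : ℝ, ‖weilMellin g (1 / 2 + τ * I)‖ ^ 2 * (π / Real.cosh (π * τ)) := by
  have hN : Real.exp (2 * t) ≤ ((⌊Real.exp (2 * t)⌋₊ : ℕ) : ℝ) + 1 := (Nat.lt_floor_add_one _).le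
  rw [keyMarkovForm_eq_weilFinitePrimeQuadraticKey hg hsupp hN (a := 1) le_rfl,
    keyMarkovForm_eq_weilFinitePrimeQuadraticKey hg hsupp hN (a := 0) (Nat.zero_le _),
    weilFinitePrimeQuadraticKey_one_eq_zero_add hg]

/-! ## Window pairings: Cauchy–Schwarz and the `cosh + γ sech` profile -/

/-- **Cauchy–Schwarz on the window**: for a test function `g` supported in `[-a, a]` (`a ≥ 0`) and a continuous
real profile `e`, `‖∫ g e‖² ≤ (∫_{[-a,a]} e²) ‖g‖₂²`. [folklore] -/
theorem norm_sq_integral_mul_real_le (hg : IsWeilTest g) {a : ℝ} (ha : 0 ≤ a) (hsupp : tsupport g ⊆ Icc (-a) a)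
    {e : ℝ → ℝ} (he : Continuous e) :
    ‖∫ x : ℝ, g x * (e x : ℂ)‖ ^ 2 ≤ (∫ x in Icc (-a) a, e x ^ 2) * ∫ x : ℝ, ‖g x‖ ^ 2 := by
  have _ := ha
  set c : ℂ := ∫ x : ℝ, g x * (e x : ℂ) with hc
  have hzero : ∀ x, x ∉ Icc (-a) a → g x = 0 := fun x hx ↦
    image_eq_zero_of_notMem_tsupport fun h ↦ hx (hsupp h)
  have hcI : c = ∫ x in Icc (-a) a, g x * (e x : ℂ) := by
    rw [hc, setIntegral_eq_integral_of_forall_compl_eq_zero]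
    intro x hx
    simp [hzero x hx]
  have hNI : ∫ t : ℝ, ‖g t‖ ^ 2 = ∫ t in Icc (-a) a, ‖g t‖ ^ 2 := by
    rw [setIntegral_eq_integral_of_forall_compl_eq_zero]
    intro x hx
    simp [hzero x hx]
  have hle : ‖c‖ ≤ ∫ x in Icc (-a) a, ‖g x‖ * |e x| := by
    rw [hcI]
    refine (norm_integral_le_integral_norm _).trans (le_of_eq ?_)
    congr 1 with x
    rw [norm_mul, Complex.norm_real, Real.norm_eq_abs]
  have hf2 : MemLp (fun x ↦ ‖g x‖) (ENNReal.ofReal 2) (volume.restrict (Icc (-a) a)) := by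
    rw [ENNReal.ofReal_ofNat, memLp_two_iff_integrable_sq (hg.1.continuous.norm.aestronglyMeasurable)]
    exact (hg.1.continuous.norm.pow 2).integrableOn_Icc
  have hk2 : MemLp (fun x ↦ |e x|) (ENNReal.ofReal 2) (volume.restrict (Icc (-a) a)) := by
    have hk : Continuous fun x ↦ |e x| := by fun_prop
    rw [ENNReal.ofReal_ofNat, memLp_two_iff_integrable_sq hk.aestronglyMeasurable]
    exact (hk.pow 2).integrableOn_Icc
  have hCS := integral_mul_le_Lp_mul_Lq_of_nonneg Real.HolderConjugate.two_two
    (Filter.Eventually.of_forall fun x ↦ norm_nonneg (g x)) (Filter.Eventually.of_forall fun x ↦ abs_nonneg (e x)) hf2 hk2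
  simp only [Real.rpow_two, sq_abs] at hCS
  have hA : 0 ≤ ∫ x in Icc (-a) a, ‖g x‖ ^ 2 := integral_nonneg fun x ↦ by positivity
  have hB : 0 ≤ ∫ x in Icc (-a) a, e x ^ 2 := integral_nonneg fun x ↦ by positivity
  have hprod : ((∫ x in Icc (-a) a, ‖g x‖ ^ 2) ^ (1 / 2 : ℝ) *
      (∫ x in Icc (-a) a, e x ^ 2) ^ (1 / 2 : ℝ)) ^ 2 =
      (∫ x in Icc (-a) a, ‖g x‖ ^ 2) * ∫ x in Icc (-a) a, e x ^ 2 := by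
    rw [mul_pow, ← Real.rpow_natCast, ← Real.rpow_natCast, ← Real.rpow_mul hA, ← Real.rpow_mul hB]
    norm_num
  calc ‖c‖ ^ 2 ≤ (∫ x in Icc (-a) a, ‖g x‖ * |e x|) ^ 2 := pow_le_pow_left₀ (norm_nonneg _) hle 2
    _ ≤ ((∫ x in Icc (-a) a, ‖g x‖ ^ 2) ^ (1 / 2 : ℝ) * (∫ x in Icc (-a) a, e x ^ 2) ^ (1 / 2 : ℝ)) ^ 2 :=
        pow_le_pow_left₀ (integral_nonneg fun x ↦ by positivity) hCS 2
    _ = (∫ x in Icc (-a) a, e x ^ 2) * ∫ t : ℝ, ‖g t‖ ^ 2 := by rw [hprod, hNI, mul_comm]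

/-- The two pole/parity pairings as ONE pairing against `e_γ(x) = cosh(x/2) + γ/(2cosh(x/2))`:
`∫ g cosh(x/2) + γ ∫ g/(2cosh(x/2)) = ∫ g e_γ`. [folklore] -/
theorem integral_mul_cosh_add_mul_integral_sech (hg : IsWeilTest g) (γ : ℝ) :
    (∫ x : ℝ, g x * (Real.cosh (x / 2) : ℂ)) + (γ : ℂ) * ∫ x : ℝ, g x / (2 * Real.cosh (x / 2) : ℂ) =
      ∫ x : ℝ, g x * ((Real.cosh (x / 2) + γ / (2 * Real.cosh (x / 2)) : ℝ) : ℂ) := by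
  have hgi : ∀ φ : ℝ → ℝ, Continuous φ → Integrable fun x ↦ g x * (φ x : ℂ) := fun φ hφ ↦
    (hg.1.continuous.mul (continuous_ofReal.comp hφ)).integrable_of_hasCompactSupport hg.2.mul_right
  have hsech : Continuous fun x : ℝ ↦ γ / (2 * Real.cosh (x / 2)) :=
    Continuous.div continuous_const (by fun_prop) fun x ↦ by positivity
  have e1 : (fun x : ℝ ↦ g x / (2 * Real.cosh (x / 2) : ℂ)) =
      fun x ↦ g x * (((1 / (2 * Real.cosh (x / 2)) : ℝ) : ℂ)) := by
    funext x
    push_cast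
    rw [div_eq_mul_one_div]
  rw [e1, ← integral_const_mul, ← integral_add (hgi _ (by fun_prop))]
  · refine integral_congr_ae (Filter.Eventually.of_forall fun x ↦ ?_)
    simp only
    push_cast
    ring
  · have := (hgi _ (Continuous.div continuous_const (by fun_prop) fun x ↦ by positivity :
      Continuous fun x : ℝ ↦ 1 / (2 * Real.cosh (x / 2)))).const_mul (γ : ℂ)
    exact this

/-- **The window energy of the profile**: `∫_{[-t,t]} (cosh(x/2) + γ/(2cosh(x/2)))² dx
= sinh t + t + 2γt + γ² tanh(t/2)` (`t ≥ 0`; antiderivative `(sinh x + x)/2 + γx + (γ²/2) tanh(x/2)`). [folklore] -/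
theorem integral_Icc_cosh_add_sech_sq {t : ℝ} (ht : 0 ≤ t) (γ : ℝ) :
    ∫ x in Icc (-t) t, (Real.cosh (x / 2) + γ / (2 * Real.cosh (x / 2))) ^ 2 =
      Real.sinh t + t + 2 * γ * t + γ ^ 2 * Real.tanh (t / 2) := by
  rw [integral_Icc_eq_integral_Ioc, ← intervalIntegral.integral_of_le (by linarith)]
  have htanh : ∀ y : ℝ, HasDerivAt (fun y ↦ Real.sinh y / Real.cosh y) (1 / Real.cosh y ^ 2) y := by
    intro y
    have hc : Real.cosh y ≠ 0 := (Real.cosh_pos y).ne'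
    have h := (Real.hasDerivAt_sinh y).div (Real.hasDerivAt_cosh y) hc
    have key : Real.cosh y * Real.cosh y - Real.sinh y * Real.sinh y = 1 := by
      linear_combination Real.cosh_sq_sub_sinh_sq y
    rw [key] at h
    exact h
  have hderiv : ∀ x ∈ uIcc (-t) t,
      HasDerivAt (fun x ↦ (Real.sinh x + x) / 2 + γ * x + γ ^ 2 / 2 * (Real.sinh (x / 2) / Real.cosh (x / 2)))
        ((Real.cosh (x / 2) + γ / (2 * Real.cosh (x / 2))) ^ 2) x := by
    intro x _
    have hx : HasDerivAt (fun x : ℝ ↦ x / 2) (1 / 2) x := (hasDerivAt_id' x).div_const 2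
    have h1 : HasDerivAt (fun x ↦ (Real.sinh x + x) / 2) ((Real.cosh x + 1) / 2) x :=
      ((Real.hasDerivAt_sinh x).add (hasDerivAt_id' x)).div_const 2
    have h2 : HasDerivAt (fun x ↦ γ * x) (γ * 1) x := (hasDerivAt_id' x).const_mul γ
    have h3 := (htanh (x / 2)).comp x hx
    simp only [Function.comp_def] at h3
    have h := (h1.add h2).add (h3.const_mul (γ ^ 2 / 2))
    refine h.congr_deriv ?_
    have hch : Real.cosh (x / 2) ≠ 0 := (Real.cosh_pos _).ne'
    have hdouble : Real.cosh x = 2 * Real.cosh (x / 2) ^ 2 - 1 := by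
      have := Real.cosh_two_mul (x / 2)
      rw [show 2 * (x / 2) = x by ring] at this
      linear_combination this - Real.cosh_sq_sub_sinh_sq (x / 2)
    rw [hdouble]
    field_simp
    ring
  have hcont : Continuous fun x : ℝ ↦ (Real.cosh (x / 2) + γ / (2 * Real.cosh (x / 2))) ^ 2 :=
    (Continuous.add (by fun_prop) (Continuous.div continuous_const (by fun_prop) fun x ↦ by positivity)).pow 2
  rw [intervalIntegral.integral_eq_sub_of_hasDerivAt hderiv (hcont.intervalIntegrable _ _)]
  rw [Real.tanh_eq_sinh_div_cosh, neg_div, Real.sinh_neg, Real.cosh_neg, Real.sinh_neg]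
  ring

/-- The rank-two algebra: `‖x + γY‖² − ‖γx + Y‖² = (1 − γ²)(‖x‖² − ‖Y‖²)` (`γ` real). [folklore] -/
theorem norm_sq_add_mul_sub (x Y : ℂ) (γ : ℝ) :
    ‖x + (γ : ℂ) * Y‖ ^ 2 - ‖(γ : ℂ) * x + Y‖ ^ 2 = (1 - γ ^ 2) * (‖x‖ ^ 2 - ‖Y‖ ^ 2) := by
  simp only [Complex.sq_norm, Complex.normSq_apply, Complex.add_re, Complex.add_im, Complex.mul_re,
    Complex.mul_im, Complex.ofReal_re, Complex.ofReal_im]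
  ring

/-! ## The odd pseudo-key is non-negative above the level `2E(t,γ)/(1 − γ²)` -/

/-- ★ **`ζ` positivity on `[-t, t]` makes the ODD pseudo-key non-negative** on test functions supported in
`[-t, t]` at every level `L` with `2(sinh t + t + 2γt + γ² tanh(t/2)) ≤ (1 − γ²)L` for some `γ² < 1`:
`keyMarkovForm 1 L 1 t g = Re Q_ζ(g) − P(g) + L‖g‖₂² + (sech form)`, `P(g) ≤ 2‖∫g cosh(x/2)‖²`,
`(sech form) ≥ 2‖∫ g/(2cosh(x/2))‖²`, and `‖x‖² − ‖Y‖² ≤ ‖x + γY‖²/(1 − γ²) ≤ E(t,γ)‖g‖₂²/(1 − γ²)`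
(Cauchy–Schwarz against `cosh(x/2) + γ/(2cosh(x/2))`).  `γ = 0` is the even law `2(sinh t + t) ≤ L`.
[cite: Yoshida1992, §6 eq. (6.2); Weil1952FormulesExplicites, (10)–(11) pp. 258–262] -/
theorem keyMarkovForm_allTrivial_one_nonneg_of_weilPositivityOn {t : ℝ} (ht : 0 ≤ t) (hζ : WeilPositivityOn t)
    {γ : ℝ} (hγ : γ ^ 2 < 1) {L : ℝ}
    (hL : 2 * (Real.sinh t + t + 2 * γ * t + γ ^ 2 * Real.tanh (t / 2)) ≤ (1 - γ ^ 2) * L)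
    (hg : IsWeilTest g) (hsupp : tsupport g ⊆ Icc (-t) t) :
    0 ≤ keyMarkovForm 1 L (fun _ ↦ 1) t g := by
  rw [keyMarkovForm_one_eq_zero_add_sech hg hsupp, keyMarkovForm_allTrivial_zero_eq,
    weilWindowForm_eq_re_weilQuadratic hg hsupp]
  set x : ℂ := ∫ u : ℝ, g u * (Real.cosh (u / 2) : ℂ) with hx
  set s : ℂ := ∫ u : ℝ, g u * (Real.sinh (u / 2) : ℂ) with hs
  set Y : ℂ := ∫ u : ℝ, g u / (2 * Real.cosh (u / 2) : ℂ) with hY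
  set S : ℝ := 1 / (2 * π) * ∫ τ : ℝ, ‖weilMellin g (1 / 2 + τ * I)‖ ^ 2 * (π / Real.cosh (π * τ)) with hS
  set Ng : ℝ := ∫ u : ℝ, ‖g u‖ ^ 2 with hNg
  set E : ℝ := Real.sinh t + t + 2 * γ * t + γ ^ 2 * Real.tanh (t / 2) with hE
  have hP : weilPoleForm g = 2 * ‖x‖ ^ 2 - 2 * ‖s‖ ^ 2 := rfl
  have h1 : 0 ≤ (weilQuadratic g).re := hζ g hg hsupp
  have hSY : 2 * ‖Y‖ ^ 2 ≤ S := two_mul_norm_sq_sech_pairing_le hg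
  have hNg0 : 0 ≤ Ng := integral_nonneg fun _ ↦ by positivity
  have hγ' : 0 < 1 - γ ^ 2 := by linarith
  -- Cauchy–Schwarz against the profile
  have hprof : Continuous fun u : ℝ ↦ Real.cosh (u / 2) + γ / (2 * Real.cosh (u / 2)) :=
    Continuous.add (by fun_prop) (Continuous.div continuous_const (by fun_prop) fun u ↦ by positivity)
  have hCS : ‖x + (γ : ℂ) * Y‖ ^ 2 ≤ E * Ng := by
    rw [hx, hY, integral_mul_cosh_add_mul_integral_sech hg γ, hE, ← integral_Icc_cosh_add_sech_sq ht γ]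
    exact norm_sq_integral_mul_real_le hg ht hsupp hprof
  have hid := norm_sq_add_mul_sub x Y γ
  have hkey : (1 - γ ^ 2) * (‖x‖ ^ 2 - ‖Y‖ ^ 2) ≤ E * Ng := by
    rw [← hid]
    linarith [sq_nonneg ‖(γ : ℂ) * x + Y‖]
  have hL' : 2 * E * Ng ≤ (1 - γ ^ 2) * L * Ng := by
    have := mul_le_mul_of_nonneg_right hL hNg0
    linarith
  have h2 : (1 - γ ^ 2) * (2 * (‖x‖ ^ 2 - ‖Y‖ ^ 2)) ≤ (1 - γ ^ 2) * (L * Ng) := by nlinarith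
  have h3 : 2 * (‖x‖ ^ 2 - ‖Y‖ ^ 2) ≤ L * Ng := le_of_mul_le_mul_left h2 hγ'
  rw [hP]
  nlinarith [sq_nonneg ‖s‖]

/-! ## The odd floor law -/

/-- ★★ **THE ODD `ζ`-TRANSFER FLOOR LAW.**  If Weil positivity holds for `ζ` on `[-t, t]` (`t > 0`) and
`2(sinh t + t + 2γt + γ² tanh(t/2)) ≤ (1 − γ²) log q` for some real `γ` with `γ² < 1`, then `WeilPositivityOnChar χ t`
for every ODD Dirichlet character `χ` mod `q ≠ 1` (any values, imprimitive allowed).  The optimal `γ ≈ −0.46…−0.5`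
lowers the even law's `2(sinh t + t)` by the parity (sech) bonus: floors `14` at `4023/5000` (cell data: `14`),
`31` at `t = 1` (data: `30`).
[cite: Weil1952FormulesExplicites, (10)–(11) pp. 258–262 and the «lemme» p. 262; Yoshida1992, §6 eq. (6.2)] -/
theorem weilPositivityOnChar_odd_of_weilPositivityOn {t : ℝ} (ht : 0 < t) (hζ : WeilPositivityOn t) {γ : ℝ}
    (hγ : γ ^ 2 < 1) (hq : q ≠ 1) (χ : DirichletCharacter ℂ q) (hodd : charParity χ = 1)
    (hL : 2 * (Real.sinh t + t + 2 * γ * t + γ ^ 2 * Real.tanh (t / 2)) ≤ (1 - γ ^ 2) * Real.log q) :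
    WeilPositivityOnChar χ t :=
  weilPositivityOnChar_of_allTrivial_test_nonneg ht
    (fun _ hg hsupp ↦ keyMarkovForm_allTrivial_one_nonneg_of_weilPositivityOn ht.le hζ hγ hL hg hsupp) hq χ hodd
    le_rfl

/-- The odd floor law with an INTEGER floor `Q ≤ q` (`Q ≥ 2` forced). [folklore] -/
theorem weilPositivityOnChar_odd_of_weilPositivityOn_of_le {t : ℝ} (ht : 0 < t) (hζ : WeilPositivityOn t)
    {γ : ℝ} (hγ : γ ^ 2 < 1) {Q : ℕ}
    (hQ : 2 * (Real.sinh t + t + 2 * γ * t + γ ^ 2 * Real.tanh (t / 2)) ≤ (1 - γ ^ 2) * Real.log Q)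
    (hQq : Q ≤ q) (χ : DirichletCharacter ℂ q) (hodd : charParity χ = 1) : WeilPositivityOnChar χ t := by
  -- the left side is `> 0`: it is `≥ (1 − γ²)·2t·(…)`; simplest: `E ≥ sinh t + t + 2γt ≥ (1 − |γ|)·2t`-free route:
  -- `E = ∫ e_γ² > 0` is not needed; we use `E ≥ sinh t + t − 2|γ|t ≥ (1 − |γ|)(sinh t + t)`-free bound below.
  have hγ1 : 0 < 1 - γ ^ 2 := by linarith
  have hE0 : 0 < Real.sinh t + t + 2 * γ * t + γ ^ 2 * Real.tanh (t / 2) := by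
    have hs : t ≤ Real.sinh t := Real.self_le_sinh_iff.2 ht.le
    have hth : 0 ≤ Real.tanh (t / 2) := by
      rw [Real.tanh_eq_sinh_div_cosh]
      exact div_nonneg (Real.sinh_nonneg_iff.2 (by linarith)) (Real.cosh_pos _).le
    have hγabs : -1 < γ := by nlinarith
    nlinarith [mul_nonneg (sq_nonneg γ) hth]
  have hQ1 : 1 < Q := by
    by_contra h
    have hQ' : (Q : ℝ) ≤ 1 := by exact_mod_cast not_lt.1 h
    have : Real.log Q ≤ 0 := Real.log_nonpos (Nat.cast_nonneg _) hQ'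
    nlinarith
  have hq : q ≠ 1 := by omega
  refine weilPositivityOnChar_odd_of_weilPositivityOn ht hζ hγ hq χ hodd (hQ.trans ?_)
  exact mul_le_mul_of_nonneg_left
    (Real.log_le_log (by exact_mod_cast (show 0 < Q by omega)) (by exact_mod_cast hQq)) hγ1.le

/-- ★★ **Unconditional odd floor law up to the `ζ` frontier** `4023/5000`
(`EvenWinsBeyondArch.weilPositivityOn_of_le_8046`). [cite: Weil1952FormulesExplicites, (10)–(11) pp. 258–262] -/
theorem weilPositivityOnChar_odd_of_le_frontier_of_le {t : ℝ} (ht : 0 < t) (htf : t ≤ 4023 / 5000)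
    {γ : ℝ} (hγ : γ ^ 2 < 1) {Q : ℕ}
    (hQ : 2 * (Real.sinh t + t + 2 * γ * t + γ ^ 2 * Real.tanh (t / 2)) ≤ (1 - γ ^ 2) * Real.log Q)
    (hQq : Q ≤ q) (χ : DirichletCharacter ℂ q) (hodd : charParity χ = 1) : WeilPositivityOnChar χ t :=
  weilPositivityOnChar_odd_of_weilPositivityOn_of_le ht
    (Summit.RiemannHypothesis.RiemannHypothesis.Theorems.EvenWinsBeyondArch.weilPositivityOn_of_le_8046 htf)
    hγ hQ hQq χ hodd


end Summit.Ventures.WeilGRH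

end
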